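import Summits.NavierStokesRegularity.NavierStokesRegularity.Theorems.OddMorawetzOrderThreeIndefiniteFields
import Summits.NavierStokesRegularity.NavierStokesRegularity.Theorems.OddMorawetzLocal.Negative.OddMorawetzLocalSymmetryDefs

/-!
# Crux `MorawetzKillsTypeI` (stmt-NavierStokesRegularity-1377) — the live weight-3 class takes both signs

Stub `stub_orderThreeLive` of the crux skeleton (line `registered`). For the enstrophy-production density on
3-jets `r(z) = ⟪ω(z₁), z₁ ω(z₁)⟫`, `ω(A) = (A₂₁ − A₁₂, A₀₂ − A₂₀, A₁₀ − A₀₁)` with `Aᵢⱼ = (A eⱼ)ᵢ` (so that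
`r(J v x) = ω·(∇v)ω` with `ω = curl v`), the Euler derivative `Q_r(v) = -∫ Dr(J v x)[J B(v,v) x] dx` is the
`OrderThreeIndefinite` form `-∫ (⟪curl b, Dv ω⟫ + ⟪ω, Db ω⟫ + ⟪ω, Dv curl b⟫)`, `b = B(v,v)`; hence it is `< 0` on
the Gaussian vortex `v₋ = (-x₁, x₀, 0)e^{-|x|²}` (`PM_value = -π√π/320`) and `> 0` on the planar field
`v₊ = (-2x₀x₁, 2x₀² - 1, 0)e^{-|x|²}` (`PP_value = 11π√π/1280`) of `OddMorawetzOrderThreeIndefiniteFields`.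

Method: `r` factors through the continuous linear maps `z ↦ z₁`, `A ↦ ω(A)` and the curry isomorphism
`A ↦ (a ↦ A (fun _ => a))` (`ContinuousMultilinearMap.ofSubsingletonₗᵢ`), so it is smooth and its derivative is the
polarisation `Dr(z)[w] = ⟪ω w₁, z₁ ω z₁⟫ + ⟪ω z₁, w₁ ω z₁⟫ + ⟪ω z₁, z₁ ω w₁⟫` (`HasFDerivAt.inner`,
`HasFDerivAt.clm_apply`); at `z = J v x`, `w = J b x` this is the `OrderThreeIndefinite` integrand by
`iteratedFDeriv_one_apply` and the definition of `Literature.Analysis.FluidPDE.curl`. Everything is proved; no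
definitions (the two linear maps are produced as existence statements).
-/

noncomputable section

open MeasureTheory MvPolynomial
open scoped RealInnerProductSpace

set_option linter.dupNamespace false

namespace Summit.NavierStokesRegularity.NavierStokesRegularity.Theorems

open Summit.NavierStokesRegularity.NavierStokesRegularity.Theorems.OddMorawetz
open Real Literature.Analysis Literature.Analysis.FluidPDE

/-- The curry isomorphism of `1`-multilinear maps as a continuous linear map, `L A a = A (fun _ => a)` (stated as an
existence so that no definition is added). -/
theorem orderThreeLive_exists_curry :
    ∃ L : (E3 [×1]→L[ℝ] E3) →L[ℝ] (E3 →L[ℝ] E3), ∀ (A : E3 [×1]→L[ℝ] E3) (a : E3), L A a = A (fun _ => a) :=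
  ⟨(ContinuousMultilinearMap.ofSubsingletonₗᵢ (G' := E3) ℝ E3
      (0 : Fin 1)).symm.toLinearIsometry.toContinuousLinearMap, fun _ _ => rfl⟩

/-- The vorticity vector of a `1`-multilinear map, `ω(A) = (A₂₁ − A₁₂, A₀₂ − A₂₀, A₁₀ − A₀₁)` with
`Aᵢⱼ = (A (fun _ => eⱼ))ᵢ`, is a continuous linear map (stated as an existence so that no definition is added). -/
theorem orderThreeLive_exists_omega :
    ∃ Ω : (E3 [×1]→L[ℝ] E3) →L[ℝ] E3, ∀ A : E3 [×1]→L[ℝ] E3, Ω A =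
      WithLp.toLp 2 ![A (fun _ => EuclideanSpace.single 1 (1 : ℝ)) 2 - A (fun _ => EuclideanSpace.single 2 (1 : ℝ)) 1,
        A (fun _ => EuclideanSpace.single 2 (1 : ℝ)) 0 - A (fun _ => EuclideanSpace.single 0 (1 : ℝ)) 2,
        A (fun _ => EuclideanSpace.single 0 (1 : ℝ)) 1 - A (fun _ => EuclideanSpace.single 1 (1 : ℝ)) 0] := by
  let c : Fin 3 → Fin 3 → ((E3 [×1]→L[ℝ] E3) →L[ℝ] ℝ) := fun j i =>
    (EuclideanSpace.proj i).comp
      (ContinuousMultilinearMap.apply ℝ (fun _ : Fin 1 => E3) E3 (fun _ => EuclideanSpace.single j (1 : ℝ)))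
  refine ⟨(c 1 2 - c 2 1).smulRight (EuclideanSpace.single 0 (1 : ℝ)) +
      (c 2 0 - c 0 2).smulRight (EuclideanSpace.single 1 (1 : ℝ)) +
      (c 0 1 - c 1 0).smulRight (EuclideanSpace.single 2 (1 : ℝ)), fun A => ?_⟩
  ext i
  fin_cases i <;> simp [c]

/-- Smoothness of the cubic form `z ↦ ⟪Ω z₁, L z₁ (Ω z₁)⟫` on 3-jets, for continuous linear `Ω`, `L`. -/
theorem orderThreeLive_contDiff (Ω : (E3 [×1]→L[ℝ] E3) →L[ℝ] E3) (L : (E3 [×1]→L[ℝ] E3) →L[ℝ] (E3 →L[ℝ] E3))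
    {n : WithTop ℕ∞} : ContDiff ℝ n (fun z : Jet3 => ⟪Ω z.2.1, L z.2.1 (Ω z.2.1)⟫) := by
  have hP : ContDiff ℝ n (fun z : Jet3 => z.2.1) := contDiff_snd.fst
  exact (Ω.contDiff.comp hP).inner ℝ ((L.contDiff.comp hP).clm_apply (Ω.contDiff.comp hP))

/-- The derivative of the cubic form `z ↦ ⟪Ω z₁, L z₁ (Ω z₁)⟫` is its polarisation. -/
theorem orderThreeLive_fderiv (Ω : (E3 [×1]→L[ℝ] E3) →L[ℝ] E3) (L : (E3 [×1]→L[ℝ] E3) →L[ℝ] (E3 →L[ℝ] E3))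
    (z w : Jet3) :
    fderiv ℝ (fun z : Jet3 => ⟪Ω z.2.1, L z.2.1 (Ω z.2.1)⟫) z w =
      ⟪Ω w.2.1, L z.2.1 (Ω z.2.1)⟫ + ⟪Ω z.2.1, L w.2.1 (Ω z.2.1)⟫ + ⟪Ω z.2.1, L z.2.1 (Ω w.2.1)⟫ := by
  let P : Jet3 →L[ℝ] (E3 [×1]→L[ℝ] E3) :=
    (ContinuousLinearMap.fst ℝ (E3 [×1]→L[ℝ] E3) ((E3 [×2]→L[ℝ] E3) × (E3 [×3]→L[ℝ] E3))).comp
      (ContinuousLinearMap.snd ℝ E3 _)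
  have hf : HasFDerivAt (fun z : Jet3 => Ω z.2.1) (Ω.comp P) z := (Ω.comp P).hasFDerivAt
  have hc : HasFDerivAt (fun z : Jet3 => L z.2.1) (L.comp P) z := (L.comp P).hasFDerivAt
  have h : HasFDerivAt (fun z : Jet3 => ⟪Ω z.2.1, L z.2.1 (Ω z.2.1)⟫) _ z := hf.inner ℝ (hc.clm_apply hf)
  rw [h.fderiv]
  simp only [P, ContinuousLinearMap.comp_apply, ContinuousLinearMap.prod_apply, fderivInnerCLM_apply,
    IsAddApply.add_apply, ContinuousLinearMap.flip_apply, ContinuousLinearMap.coe_fst',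
    ContinuousLinearMap.coe_snd', inner_add_right]
  ring

/-- **stub `stub_orderThreeLive` — the live weight-3 class takes both signs.** For the enstrophy-production density
`r(z) = ⟪ω(z₁), z₁ ω(z₁)⟫` (`ω(A) = (A₂₁−A₁₂, A₀₂−A₂₀, A₁₀−A₀₁)`, `Aᵢⱼ = (z₁ eⱼ)ᵢ`, so `r(Jv) = ω·(∇v)ω`), `r` is
smooth and the Euler derivative `Q_r(v) = -∫ Dr(Jv)[J B(v,v)]` is the `OrderThreeIndefinite` form
`-∫(⟪curl b, Dv ω⟫ + ⟪ω, Db ω⟫ + ⟪ω, Dv curl b⟫)`, hence `< 0` on the Gaussian vortex `v₋ = (-x₁, x₀, 0)e^{-|x|²}` and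
`> 0` on the planar field `v₊ = (-2x₀x₁, 2x₀²-1, 0)e^{-|x|²}` (`PM_value`, `PP_value`). -/
theorem stub_orderThreeLive :
    let e : Fin 3 → E3 := fun i => EuclideanSpace.single i (1 : ℝ);
    let ω : (E3 [×1]→L[ℝ] E3) → E3 := fun A =>
      WithLp.toLp 2 ![A (fun _ => e 1) 2 - A (fun _ => e 2) 1, A (fun _ => e 2) 0 - A (fun _ => e 0) 2,
        A (fun _ => e 0) 1 - A (fun _ => e 1) 0];
    let r : Jet3 → ℝ := fun z => inner ℝ (ω z.2.1) (z.2.1 (fun _ => ω z.2.1));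
    let J := fun (v : E3 → E3) (x : E3) => ((v x, iteratedFDeriv ℝ 1 v x, iteratedFDeriv ℝ 2 v x, iteratedFDeriv ℝ 3 v x) : Jet3);
    let Q := fun (v : E3 → E3) => -∫ x, fderiv ℝ r (J v x) (J (Literature.Analysis.FluidPDE.eulerBilinear v v) x);
    ContDiff ℝ (⊤ : ℕ∞) r ∧
    (∃ v, Literature.Analysis.FluidPDE.IsSchwartzField v ∧ Literature.Analysis.FluidPDE.VectorCalculus.IsDivFree v ∧
        Q v < 0) ∧
    (∃ v, Literature.Analysis.FluidPDE.IsSchwartzField v ∧ Literature.Analysis.FluidPDE.VectorCalculus.IsDivFree v ∧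
        0 < Q v) := by
  intro e ω r J Q
  obtain ⟨L, hL⟩ := orderThreeLive_exists_curry
  obtain ⟨Ω, hΩ⟩ := orderThreeLive_exists_omega
  -- `ω` is the continuous linear map `Ω`, and `r` is the cubic form of `Ω`, `L`
  have hΩω : ∀ A, Ω A = ω A := fun A => hΩ A
  have hr : r = fun z => ⟪Ω z.2.1, L z.2.1 (Ω z.2.1)⟫ := by
    funext z
    simp only [r, hΩω, hL]
  -- on jets of fields: the first-order component, its vorticity and its action
  have hJ : ∀ (u : E3 → E3) (x : E3), (J u x).2.1 = iteratedFDeriv ℝ 1 u x := fun u x => rfl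
  have hcurl : ∀ (u : E3 → E3) (x : E3), Ω (iteratedFDeriv ℝ 1 u x) = curl u x := by
    intro u x
    rw [hΩ]
    simp only [iteratedFDeriv_one_apply]
    rfl
  have hD : ∀ (u : E3 → E3) (x a : E3), L (iteratedFDeriv ℝ 1 u x) a = fderiv ℝ u x a := by
    intro u x a
    rw [hL, iteratedFDeriv_one_apply]
  -- the Euler derivative is the `OrderThreeIndefinite` form
  have hQ : ∀ v : E3 → E3, Q v = -∫ x, (⟪curl (eulerBilinear v v) x, fderiv ℝ v x (curl v x)⟫ +
      ⟪curl v x, fderiv ℝ (eulerBilinear v v) x (curl v x)⟫ +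
        ⟪curl v x, fderiv ℝ v x (curl (eulerBilinear v v) x)⟫) := by
    intro v
    show -∫ x, fderiv ℝ r (J v x) (J (eulerBilinear v v) x) = _
    simp only [hr, orderThreeLive_fderiv, hJ, hcurl, hD]
  have hπ : 0 < π * Real.sqrt π := mul_pos pi_pos (Real.sqrt_pos.2 pi_pos)
  refine ⟨?_, ?_, ?_⟩
  · rw [hr]
    exact orderThreeLive_contDiff Ω L
  · refine ⟨pgv 1 (![-X 1, X 0, 0] : Fin 3 → P3), isSchwartzField_pgv 1 one_pos _, isDivFree_pgv _ PM_div, ?_⟩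
    rw [hQ, PM_value]
    linarith
  · refine ⟨pgv 1 (![-(2 * X 0 * X 1), 2 * X 0 ^ 2 - 1, 0] : Fin 3 → P3), isSchwartzField_pgv 1 one_pos _,
      isDivFree_pgv _ PP_div, ?_⟩
    rw [hQ, PP_value]
    linarith

end Summit.NavierStokesRegularity.NavierStokesRegularity.Theorems

end
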